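import Literature.MathematicalPhysics.QuantumLattice.DWaveSourceParticleHole
import Literature.MathematicalPhysics.QuantumLattice.DWaveSourceProofs
import Literature.MathematicalPhysics.QuantumLattice.FermionQuasiFreeBounds
import Literature.MathematicalPhysics.QuantumLattice.GroundStateDensityMatrixSupport
import Literature.MathematicalPhysics.QuantumLattice.TransverseWardIdentity
import Literature.MathematicalPhysics.QuantumLattice.PairedProductStatesInteraction
import Literature.MathematicalPhysics.QuantumLattice.HubbardGrandCanonicalDensity
import HarnessLib

/-!
# A SOURCED CAP for the pinning-field bracket (I): the free pinned Gibbs state as a trial state, and the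
# transport of its expectations to the Nambu one-body Fermi matrix

HONEST FRAMING: zero compute; every statement is a PROVED finite-volume identity / inequality; no number is
claimed; the output (this file and its sequel `SourcedGibbsTrialCapHFBCS.lean`) is a CAP
`E₀(A_L(h)) ≤ (explicit one-body functional)` on the SOURCED ground energy whose evaluation (certified free-BdG
sums) is pilot / hubbard-upper work (cell `hubbard-cq` ruling W4); a sourced cap feeds the FLOOR edge of the
Hellmann–Feynman bracket (`Observables/PinningFieldResponseBracketDWave.lean`, `floor_nonpos_of_sourceFree_cap`:
without a sourced cap the floor is vacuous); not a statement about order of the source-free model; not a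
superconductivity verdict.

Cell `hubbard-obs` (D-0042 / D-0082 (c-2)), seat `hubbard-obs-pin-2` (`prover-hubbard-obs-pin-2-g0-0`); ruling W4 of
`pub/hubbard-cq/START-HERE.md` §9 («HF–BCS SOURCED CAP typing → pin-2, finite-L skeleton; obsth-1 consumes; numbers
by a pilot / hubbard-upper»).

## The cap (this file: §1–§3)

`A_L(U,μ,h) = dWaveSourceTorus L U μ h = H_L(1,U) − μN_L − h(Δ_d + Δ_dᴴ)` on the torus `(ℤ/Lℤ)²`. For ANY density
matrix `ρ`, `E₀(A_L(U,μ,h)) ≤ Re tr(ρ A_L(U,μ,h))` (variational principle, `groundEnergy_le_re_trace_mul_of_isDensityMatrix`);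
with `A_L(U,μ,h) = A_L(0,μ',h) + (μ'−μ)N_L + U·Σ_x n_{x↑}n_{x↓}` (`dWaveSourceTorus_eq_free_add`) and `ρ` the Gibbs
state `ρ_β` of the FREE pinned torus `A_L(0,μ',h)` (any `β`, any trial chemical potential `μ'`):

  `E₀(A_L(U,μ,h)) ≤ Re⟨A_L(0,μ',h)⟩_β + (μ'−μ)·Re⟨N_L⟩_β + U·Re⟨Σ_x n_{x↑}n_{x↓}⟩_β`   (§1–§2, assembled in the sequel),

and the free thermal expectations are ONE-BODY quantities: by Lieb's partial particle–hole transformation `W`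
(`partialParticleHole_conj_dWaveSourceTorus`: `W A_L(0,μ',h) Wᴴ = dΓ(𝓗) − μ'L²·1`, `𝓗` the Nambu matrix of the
`d`-wave pinned torus) the Gibbs state of `A_L(0,μ',h)` is the Gibbs state of the NUMBER-CONSERVING quadratic `dΓ(𝓗)`
read through `W` (§3, `gibbsState_eq_nambu_of_conj`, stated for any Nambu data `(𝓗, c)` with `W A Wᴴ = dΓ(𝓗) − c·1`),
whose two-point function is the Fermi matrix `F = (1 + e^{β𝓗})⁻¹` (`thermalCorr_dGamma_creation_annihilation`):
`⟨n_{x↑}⟩_β = F_{x↑,x↑}`, `⟨n_{x↓}⟩_β = 1 − F_{x↓,x↓}` (`W n_{x↓} Wᴴ = 1 − n_{x↓}`), `⟨N_L⟩_β`, `⟨A⟩_{β,A} = Σ 𝓗_{ij}F_{ji} − c`.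
The double occupancy (Gaudin's determinant) and the assembled Hartree–Fock–BCS cap are in the sequel.

Instance note: §3 is stated for a GENERIC finite lattice `Λ` (`[LinearOrder Λ]`), where the generic CAR /
particle–hole / quasi-free lemmas apply verbatim; the sequel specialises to the torus `FermionTorus 2 L` with the library
instances of the concrete torus (the two `DecidableEq` paths there agree — `Subsingleton` — and are bridged by `convert`).

## Contents

* §1 `isDensityMatrix_gibbs`, `groundEnergy_le_re_gibbsState` (Gibbs trial states), `gibbsState_sub_smul_one`
  (shift invariance).
* §2 `dWaveSourceTorus_eq_free_add` (the torus decomposition feeding the cap).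
* §3 (GENERIC lattice `Λ`, any `A` with `W A Wᴴ = dΓ(𝓗) − c·1`): `gibbsState_eq_nambu_of_conj` (transport through
  `W`), `gibbsState_numberOp_up/_down_of_conj`, `gibbsState_totalNumber_of_conj`, `gibbsState_self_of_conj` (densities and
  energy = Fermi-matrix expressions).

References: V. Bach, E. H. Lieb, J. P. Solovej, J. Stat. Phys. 76 (1994) 3, §2 (generalized Hartree–Fock states)
[BachLiebSolovej1994]; E. H. Lieb, PRL 62 (1989) 1201, proof of Thm 2 (partial particle–hole transformation) [Lieb1989];
O. Bratteli, D. W. Robinson, *OAQSM 2* (1997) §5.2.4, §5.3.1 [BratteliRobinsonII1997]; H. Tasaki (2020) §2.1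
(variational principle) [Tasaki2020]; T. Koma, H. Tasaki, J. Stat. Phys. 76 (1994) 745, §1 (the pinned Hamiltonian)
[KomaTasaki1994].
Tree search: `lean search 'groundEnergy_dWaveSourceTorus_le'` — only `…_le` (source never raises the energy) and
`…_le_add_coupling` (`E₀(H_{U,h}) ≤ E₀(H_{0,h}) + U·L²`, crux workfile); no quasi-free / HF–BCS sourced cap;
`lean search 'isDensityMatrix_gibbs|groundEnergy_le_re_gibbsState'` — nothing.
-/

noncomputable section

namespace Summit.Ventures.CertifiedManyBodySolver.Observables

open Matrix Literature.MathematicalPhysics.QuantumLattice Literature.Probability.LatticeModels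
open Literature.MathematicalPhysics.QuantumLattice.HubbardWave0
open Literature.Barriers.HubbardSuperconductivity (IsDensityMatrix)
open scoped ComplexOrder BigOperators

/-! ### §1 Gibbs trial states: the variational principle -/

section Gibbs

variable {n : Type*} [Fintype n] [DecidableEq n]

/-- The normalised Gibbs weight `Z⁻¹ e^{−βB}` of a Hermitian `B` is a density matrix. [cite: BratteliRobinsonII1997, §5.3.1] -/
theorem isDensityMatrix_gibbs (β : ℝ) {B : Matrix n n ℂ} (hB : B.IsHermitian) [Nonempty n] :
    IsDensityMatrix ((partitionFn β B)⁻¹ • gibbsWeight β B) := by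
  have hZ : 0 < partitionFn β B := partitionFn_pos β hB
  refine ⟨(posDef_gibbsWeight β hB).posSemidef.smul (le_of_lt (inv_pos.2 hZ)), ?_⟩
  rw [trace_smul, smul_eq_mul, ← partitionFn, inv_mul_cancel₀ hZ.ne']

/-- **Gibbs trial states**: for Hermitian `A`, `B` and any real `β`, `E₀(A) ≤ Re⟨A⟩_{β,B}` (the Gibbs state of `B`
is a density matrix, `tr((Z⁻¹e^{−βB})A) = ⟨A⟩_{β,B}` — `Matrix.trace_gibbsDensity_mul` of `GibbsVariationalPrinciple.lean`,
re-derived inline — and the variational principle `groundEnergy_le_re_trace_mul_of_isDensityMatrix`; the same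
statement with the roles named `(H, A)` is the pub-hubbard helper `HubbardLadder.Bounds.groundEnergy_le_re_gibbsState`).
[cite: Tasaki2020, §2.1] [cite: BratteliRobinsonII1997, §5.3.1] -/
theorem groundEnergy_le_re_gibbsState (β : ℝ) {A B : Matrix n n ℂ} (hA : A.IsHermitian) (hB : B.IsHermitian)
    [Nonempty n] : A.groundEnergy ≤ (gibbsState β B A).re := by
  have htr : (((partitionFn β B)⁻¹ • gibbsWeight β B) * A).trace = gibbsState β B A := by
    rw [Matrix.smul_mul, trace_smul, smul_eq_mul, gibbsState_apply]
  rw [← htr]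
  exact groundEnergy_le_re_trace_mul_of_isDensityMatrix hA (isDensityMatrix_gibbs β hB)

/-- **Shift invariance of Gibbs states**: `⟨·⟩_{β, H − c·1} = ⟨·⟩_{β, H}` for every complex `c`
(`e^{−β(H − c)} = e^{βc} e^{−βH}` and the scalar cancels in the ratio). [cite: BratteliRobinsonII1997, §5.3.1] -/
theorem gibbsState_sub_smul_one (β : ℝ) (H : Matrix n n ℂ) (c : ℂ) (A : Matrix n n ℂ) :
    gibbsState β (H - c • (1 : Matrix n n ℂ)) A = gibbsState β H A := by
  have hw : gibbsWeight β (H - c • (1 : Matrix n n ℂ)) = Complex.exp (-(β : ℂ) * (-c)) • gibbsWeight β H := by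
    rw [sub_eq_add_neg, ← neg_smul, gibbsWeight_add_smul_one]
  have he : Complex.exp (-(β : ℂ) * (-c)) ≠ 0 := Complex.exp_ne_zero _
  rw [gibbsState_apply, gibbsState_apply, partitionFn, partitionFn, hw, trace_smul, Matrix.smul_mul, trace_smul,
    smul_eq_mul, smul_eq_mul, mul_inv]
  set e := Complex.exp (-(β : ℂ) * (-c))
  calc e⁻¹ * (gibbsWeight β H).trace⁻¹ * (e * (gibbsWeight β H * A).trace)
      = (e⁻¹ * e) * ((gibbsWeight β H).trace⁻¹ * (gibbsWeight β H * A).trace) := by ring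
    _ = (gibbsWeight β H).trace⁻¹ * (gibbsWeight β H * A).trace := by rw [inv_mul_cancel₀ he, one_mul]

end Gibbs

/-! ### §2 The cap from the free pinned Gibbs state -/

section Cap

variable (L : ℕ) [NeZero L]

/-- **Decomposition of the pinned torus**: `A_L(U,μ,h) = A_L(0,μ',h) + (μ' − μ)·N_L + U·Σ_x n_{x↑}n_{x↓}` for any
trial chemical potential `μ'`. [cite: KomaTasaki1994, §1] -/
theorem dWaveSourceTorus_eq_free_add (U μ μ' h : ℝ) :
    dWaveSourceTorus L U μ h = dWaveSourceTorus L 0 μ' h + ((μ' - μ : ℝ) : ℂ) • totalNumber +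
      (U : ℂ) • ∑ x : FermionTorus 2 L, numberOp x 0 * numberOp x 1 := by
  have hU : dWaveSourceTorus L U μ h = dWaveSourceTorus L 0 μ h +
      (U : ℂ) • ∑ x : FermionTorus 2 L, numberOp x 0 * numberOp x 1 := by
    have hsub : dWaveSourceTorus L U μ h - dWaveSourceTorus L 0 μ h =
        (U : ℂ) • ∑ x : FermionTorus 2 L, numberOp x 0 * numberOp x 1 := by
      rw [dWaveSourceTorus_eq, dWaveSourceTorus_eq, sub_sub_sub_cancel_right, hubbardTorusWith, hubbardTorusWith,
        hamiltonianWith_sub_hamiltonianWith, sub_zero]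
    rw [← hsub]; abel
  have hμ : dWaveSourceTorus L 0 μ h = dWaveSourceTorus L 0 μ' h + ((μ' - μ : ℝ) : ℂ) • totalNumber := by
    rw [dWaveSourceTorus_eq, dWaveSourceTorus_eq, hubbardTorusWith_eq, hubbardTorusWith_eq, Complex.ofReal_sub,
      sub_smul]
    abel
  rw [hU, hμ]

end Cap

/-! ### §3 Transport to the Nambu picture: densities are Fermi-matrix entries -/

section Nambu

variable {Λ : Type*} [LinearOrder Λ] [Fintype Λ]

/-- **Transport through the partial particle–hole transformation.** If `W A Wᴴ = dΓ(𝓗) − c·1` with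
`W = partialParticleHole D↓` (unitary), then the Gibbs state of `A` is the Gibbs state of the number-conserving
quadratic `dΓ(𝓗)` read through `W`: `⟨X⟩_{β,A} = ⟨W X Wᴴ⟩_{β,dΓ(𝓗)}`. [cite: Lieb1989, proof of Theorem 2]
[cite: BratteliRobinsonII1997, §5.3.1] -/
theorem gibbsState_eq_nambu_of_conj {A : Matrix (Finset (Orb Λ)) (Finset (Orb Λ)) ℂ}
    {𝓗 : Matrix (Orb Λ) (Orb Λ) ℂ} {c : ℂ}
    (hA : partialParticleHole (spinDownOrbitals : Finset (Orb Λ)) * A *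
      (partialParticleHole (spinDownOrbitals : Finset (Orb Λ)))ᴴ = dGamma 𝓗 - c • 1)
    (β : ℝ) (X : Matrix (Finset (Orb Λ)) (Finset (Orb Λ)) ℂ) :
    gibbsState β A X =
      gibbsState β (dGamma 𝓗) (partialParticleHole (spinDownOrbitals : Finset (Orb Λ)) * X *
        (partialParticleHole (spinDownOrbitals : Finset (Orb Λ)))ᴴ) := by
  set W := partialParticleHole (spinDownOrbitals : Finset (Orb Λ)) with hW
  have hWW : W * Wᴴ = 1 := partialParticleHole_mul_conjTranspose _
  have hW'W : Wᴴ * W = 1 := partialParticleHole_conjTranspose_mul _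
  have hunit : IsUnit W := ⟨⟨W, Wᴴ, hWW, hW'W⟩, rfl⟩
  have hinv : W⁻¹ = Wᴴ := Matrix.inv_eq_right_inv hWW
  have key := gibbsState_conj_eq β hunit A X
  rw [hinv, hA] at key
  rw [← key, gibbsState_sub_smul_one]

/-- **Spin-up density = Fermi-matrix entry**: under the hypotheses of `gibbsState_eq_nambu_of_conj` with `𝓗`
Hermitian, `⟨n_{x↑}⟩_{β,A} = F_{x↑,x↑}`, `F = (1 + e^{β𝓗})⁻¹`. [cite: BratteliRobinsonII1997, §5.2.4] -/
theorem gibbsState_numberOp_up_of_conj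
    {A : Matrix (Finset (Orb Λ)) (Finset (Orb Λ)) ℂ}
    {𝓗 : Matrix (Orb Λ) (Orb Λ) ℂ} (h𝓗 : 𝓗.IsHermitian) {c : ℂ}
    (hA : partialParticleHole (spinDownOrbitals : Finset (Orb Λ)) * A *
      (partialParticleHole (spinDownOrbitals : Finset (Orb Λ)))ᴴ = dGamma 𝓗 - c • 1)
    (β : ℝ) (x : Λ) :
    gibbsState β A (numberOp x 0) = (1 + NormedSpace.exp ((β : ℂ) • 𝓗))⁻¹ (orb x 0) (orb x 0) := by
  rw [gibbsState_eq_nambu_of_conj hA, partialParticleHole_conj_numberOp_up, numberOp]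
  exact thermalCorr_dGamma_creation_annihilation h𝓗 β (orb x 0) (orb x 0)

/-- **Spin-down density**: `⟨n_{x↓}⟩_{β,A} = 1 − F_{x↓,x↓}` (`W n_{x↓} Wᴴ = 1 − n_{x↓}`).
[cite: BratteliRobinsonII1997, §5.2.4] [cite: Lieb1989, proof of Theorem 2] -/
theorem gibbsState_numberOp_down_of_conj
    {A : Matrix (Finset (Orb Λ)) (Finset (Orb Λ)) ℂ}
    {𝓗 : Matrix (Orb Λ) (Orb Λ) ℂ} (h𝓗 : 𝓗.IsHermitian) {c : ℂ}
    (hA : partialParticleHole (spinDownOrbitals : Finset (Orb Λ)) * A *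
      (partialParticleHole (spinDownOrbitals : Finset (Orb Λ)))ᴴ = dGamma 𝓗 - c • 1)
    (β : ℝ) (x : Λ) :
    gibbsState β A (numberOp x 1) = 1 - (1 + NormedSpace.exp ((β : ℂ) • 𝓗))⁻¹ (orb x 1) (orb x 1) := by
  haveI : Nonempty (Finset (Orb Λ)) := ⟨∅⟩
  have hZ : partitionFn β (dGamma 𝓗) ≠ 0 := (partitionFn_pos β (isHermitian_dGamma h𝓗)).ne'
  rw [gibbsState_eq_nambu_of_conj hA, partialParticleHole_conj_numberOp_down, map_sub, gibbsState_one β _ hZ,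
    numberOp]
  congr 1
  exact thermalCorr_dGamma_creation_annihilation h𝓗 β (orb x 1) (orb x 1)

/-- **Total particle number**: `⟨N_L⟩_{β,A} = Σ_x (F_{x↑,x↑} + (1 − F_{x↓,x↓}))`.
[cite: BratteliRobinsonII1997, §5.2.4] -/
theorem gibbsState_totalNumber_of_conj
    {A : Matrix (Finset (Orb Λ)) (Finset (Orb Λ)) ℂ}
    {𝓗 : Matrix (Orb Λ) (Orb Λ) ℂ} (h𝓗 : 𝓗.IsHermitian) {c : ℂ}
    (hA : partialParticleHole (spinDownOrbitals : Finset (Orb Λ)) * A *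
      (partialParticleHole (spinDownOrbitals : Finset (Orb Λ)))ᴴ = dGamma 𝓗 - c • 1)
    (β : ℝ) :
    gibbsState β A totalNumber = ∑ x : Λ,
      ((1 + NormedSpace.exp ((β : ℂ) • 𝓗))⁻¹ (orb x 0) (orb x 0) +
        (1 - (1 + NormedSpace.exp ((β : ℂ) • 𝓗))⁻¹ (orb x 1) (orb x 1))) := by
  rw [totalNumber, map_sum]
  refine Finset.sum_congr rfl fun x _ => ?_
  rw [Fin.sum_univ_two, map_add, gibbsState_numberOp_up_of_conj h𝓗 hA, gibbsState_numberOp_down_of_conj h𝓗 hA]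

/-- **The energy**: `⟨A⟩_{β,A} = ⟨dΓ(𝓗)⟩_{β,dΓ(𝓗)} − c = Σ_{i,j} 𝓗_{ij} F_{ji} − c`.
[cite: BratteliRobinsonII1997, §5.2.4] -/
theorem gibbsState_self_of_conj
    {A : Matrix (Finset (Orb Λ)) (Finset (Orb Λ)) ℂ}
    {𝓗 : Matrix (Orb Λ) (Orb Λ) ℂ} (h𝓗 : 𝓗.IsHermitian) {c : ℂ}
    (hA : partialParticleHole (spinDownOrbitals : Finset (Orb Λ)) * A *
      (partialParticleHole (spinDownOrbitals : Finset (Orb Λ)))ᴴ = dGamma 𝓗 - c • 1)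
    (β : ℝ) :
    gibbsState β A A = (∑ i : Orb Λ, ∑ j : Orb Λ,
      𝓗 i j * (1 + NormedSpace.exp ((β : ℂ) • 𝓗))⁻¹ j i) - c := by
  haveI : Nonempty (Finset (Orb Λ)) := ⟨∅⟩
  have hZ : partitionFn β (dGamma 𝓗) ≠ 0 := (partitionFn_pos β (isHermitian_dGamma h𝓗)).ne'
  rw [gibbsState_eq_nambu_of_conj hA, hA, map_sub, LinearMap.map_smul_of_tower, gibbsState_one β _ hZ, smul_eq_mul,
    mul_one, dGamma_eq, map_sum]
  congr 1
  refine Finset.sum_congr rfl fun i _ => ?_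
  rw [map_sum]
  refine Finset.sum_congr rfl fun j _ => ?_
  rw [LinearMap.map_smul_of_tower, smul_eq_mul]
  congr 1
  exact thermalCorr_dGamma_creation_annihilation h𝓗 β i j

end Nambu

end Summit.Ventures.CertifiedManyBodySolver.Observables

end
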